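/-
Origin: expansion seat `planner-pub-hodgecm-pv06-g6-0`, handover #6 v2 (CLAIM 2026-08-18T14:04:36Z with v1 4e0f0ee95360373b296707e9f8635aa4; doc-only v2 14:06Z = origin-header restyle, code residue identical; window closed 14:14:36Z, adv2-g38 in-window NO OBJECTION; HANDOVER #6 2026-08-18T14:15:42Z) md5 d115c764f6275f4a6d68502f608a4434 (416 l.); class T additive KERNEL leaf (non-compact dilation toy of door [D5‴]); imports TREE `HodgeCM.PerL34.LocalFactors.Dila (`HOME/pub-hodgecm-pv06-g6/lean/Pv06g6/ArchCOrbitDilation.lean`, md5 d115c764, 416 lines);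
landed by the gen-8 packager in gate run 30 as `HodgeCM/PerL34/ArchCOrbitDilation.lean` (verbatim).
-/
/-
  HodgeCM/PerL34/ArchCOrbitDilation.lean   (seat of origin: pub-hodgecm-pv06-g6, DAG-NODE PROVER #06 generation 6,
  WIP module `Pv06g6.ArchCOrbitDilation`, session planner-pub-hodgecm-pv06-g6-0, 2026-08-18; imports are TREE modules
  and Mathlib only — no rewrite at intake).  KERNEL only: nothing cited enters as a hypothesis, nothing asserted, no placeholders.
Class of every declaration: T (toy / non-vacuity witness for the S4 analytic input), NOT a discharge of N29.

# Door [D5‴] in a NON-COMPACT direction: the dilation one-parameter group on `L²(ℝ)`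

Node N29 = PerL v5 Lemma 4.1(c), tex ll. 488–490 / 513–523 (seam S4).  The one archimedean analytic input of
the S4 record is typed three ways in this seat's RUN-30 leaves (`ArchCOrbit` [D5] `FockOrbitBridge.hF`,
`ArchCOrbitSmooth` [D5′] `FockSmoothBridge.smooth`, `ArchCOrbitTheta` [D5‴] `FockThetaBridge.thetaC1`); its
SHAPE is: for a unitary representation `R` of a group containing one-parameter subgroups `e_j : ℝ → G` and
vectors `Θ` in a smooth domain,
  `HasDerivAt (fun s => R (e_j s) Θ) Θ' 0`   in the NORM of the Hilbert space.
The directions N29 needs are the LADDER directions `X_j ∈ 𝔭 ⊂ 𝔲(W_b) ≅ 𝔲(2,1)` — NON-COMPACT ones.  The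
model-level derivative leaves in the tree / the RUN-30 queue cover COMPACT directions (pv05-g7
`FockOneParameter` / `FockAnalyticVectors`: `𝔲(σ)` acting by substitution on Fock polynomials) and HEISENBERG
directions (pv14-g6 `SchwartzMultiplierDeriv` / `SchwartzTranslationDeriv` / `SchrodingerInfinitesimal` /
`SchrodingerSmoothVectors`); the non-vacuity toys of this seat (`ArchCOrbitSmoke`, `ArchCOrbitThetaSmoke`) are
finite-dimensional.  THIS FILE is the rank-one NON-COMPACT, INFINITE-DIMENSIONAL, UNBOUNDED-GENERATOR instance:

* the group: `ℝ`, through the one-parameter subgroup `expUnit : t ↦ e^t ∈ ℝˣ` (`expUnit_add`);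
* the representation: pv07-g2's CONSTRUCTED unitary dilation representation (tree
  `LocalFactors.DilationModel.dilationRep`, gate run 24) specialised to `ℝˣ` acting on `(ℝ, dx)`:
  `U t := dilationRep volume 1 (expUnit t) : L²(ℝ) ≃ₗᵢ[ℂ] L²(ℝ)`, `(U t f)(x) = e^{t/2} f(e^t x)` a.e.
  (`coeFn_U`; the module of `ℝˣ ↷ ℝ` is `|u|`, `distribHaarChar_real_units`, so pv07's weight `δ^{1/2}` is
  `e^{t/2}`, `weight_expUnit`), a unitary one-parameter GROUP (`U_zero`, `U_add`);
* the smooth domain: the Schwartz space `𝓢(ℝ, ℂ)` (Mathlib), embedded by `SchwartzMap.toLp`; on it the group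
  acts by the Schwartz-space operators `dil t` (`dil_apply`, `toLp_dil : U t Φ = dil t Φ` in `L²`);
* the generator: `gen Φ = ½ Φ + x Φ'` (`gen_apply`), an UNBOUNDED operator preserving `𝓢` —
  `x d/dx + ½` is, under the standard identification of the dilations with the metaplectic action of the
  split torus `a(r) = diag(r, r⁻¹)` of `SL₂(ℝ)` in the Schrödinger model, the image of the hyperbolic element
  `H = diag(1, −1)`, which spans a NON-COMPACT line: `H ∈ 𝔭` for the Cartan decomposition
  `𝔰𝔩₂(ℝ) = 𝔰𝔬(2) ⊕ 𝔭` (orientation remark only; nothing of it is used or claimed in the kernel);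
* THE DOOR STATEMENT, proved: `hasDerivAt_U : HasDerivAt (fun t => U t (Φ.toLp 2)) (U t₀ ((gen Φ).toLp 2)) t₀`
  for every Schwartz `Φ` and every `t₀` (at `t₀ = 0`: `hasDerivAt_U_zero`, derivative `(gen Φ).toLp 2`), i.e.
  literally the shape of `FockThetaBridge.thetaC1` / `FockSmoothBridge.smooth` with `R = U`, `e = id`,
  `Θ = Φ`, `X·Θ = gen Φ`; and the pointwise engine `hasDerivAt_dil_apply` (every `x`, every `t`).

PROOF (elementary, no dominated convergence): pointwise in `x`, `s ↦ (dil s Φ)(x) = e^{s/2} Φ(e^s x)` is `C²`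
with first/second derivative `(dil s (gen Φ))(x)` / `(dil s (gen² Φ))(x)` (`hasDerivAt_dil_apply` applied
twice); a two-step mean-value bound (`taylor_two_bound`) gives
`|x|^i · ‖(dil h Φ − Φ − h·gen Φ)(x)‖ ≤ h² · e^{i+1/2} · p_{i,0}(gen² Φ)` for `|h| ≤ 1` (`norm_pow_mul_dil_le`:
the dilates of a Schwartz function by `e^s`, `|s| ≤ 1`, have `(i,0)`-seminorm at most `e^{i+1/2}` times the
original); hence every Schwartz seminorm `p_{i,0}` of the remainder `rem h Φ = h⁻¹(dil h Φ − Φ) − gen Φ` is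
`O(|h|)` (`seminorm_rem_le`), and Mathlib's `SchwartzMap.norm_toLp_le_seminorm` (the `L²` norm of a Schwartz
function is controlled by finitely many `p_{i,0}`) turns this into `‖(rem h Φ).toLp 2‖ ≤ C |h|`
(`norm_toLp_rem_le`), which is the little-o estimate of `hasDerivAt_toLp_dil_zero`; `toLp_dil` transports it
to `U`, and the group law + continuity of the unitary `U t₀` moves it to every `t₀`.

WHAT IT IS NOT (honest label): not the N29 discharge — that needs the operators `ω_∞(g)`, `g ∈ U(W_b)(ℝ)`, on
the model `𝓕^κ_b` and the specific ladder elements `X_j`; here the group is the rank-one hyperbolic line and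
the model is `L²(ℝ)`.  It shows that the ANALYTIC CONTENT of the typed S4 input in a non-compact direction —
a Fréchet-smooth-vector statement (referee adv2-g35 O14-R: smooth vectors = Schwartz space, Folland 1989
p. 165 (4.47) + Reed–Simon I Thm. V.13 + Folland Thm. (4.45); Poulsen 1972 Prop. 1.2 + Thm. 1.2 p. 93) — is
provable with today's Mathlib, in the simplest instance where the generator is a genuinely unbounded
first-order operator and the group is non-compact.
-/
import Summits.HodgeConjecture.HodgeCM.PerL34.LocalFactors.DilationModel_2
import Mathlib.Analysis.Distribution.SchwartzSpace.Deriv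
import Mathlib.Analysis.Calculus.Deriv.Shift
import Mathlib.MeasureTheory.Measure.Lebesgue.EqHaar

/-! # ArchCOrbitDilation — door [D5‴] on `L²(ℝ)` along the dilation group (node N29, class T) -/

noncomputable section

open MeasureTheory SchwartzMap HodgeCM.PerL34.LocalFactors.DilationModel
open scoped ENNReal Pointwise NNReal Topology

namespace HodgeCM.PerL34.ArchC.DilationToy

/-! ## §1  The one-parameter subgroup `t ↦ e^t` of `ℝˣ` and the unitary dilation group on `L²(ℝ)` -/

/-- the one-parameter subgroup `t ↦ e^t ∈ ℝˣ` -/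
def expUnit (t : ℝ) : ℝˣ := Units.mk0 (Real.exp t) (Real.exp_pos t).ne'

/-- (Ported verbatim from the HodgeCMPerL package; no docstring in the source.) -/
@[simp] theorem coe_expUnit (t : ℝ) : (expUnit t : ℝ) = Real.exp t := rfl

/-- (Ported verbatim from the HodgeCMPerL package; no docstring in the source.) -/
@[simp] theorem expUnit_zero : expUnit 0 = 1 := Units.ext (by simp)

/-- (Ported verbatim from the HodgeCMPerL package; no docstring in the source.) -/
theorem expUnit_add (s t : ℝ) : expUnit (s + t) = expUnit s * expUnit t :=
  Units.ext (by simp [Real.exp_add])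

/-- (Ported verbatim from the HodgeCMPerL package; no docstring in the source.) -/
theorem expUnit_smul (t x : ℝ) : expUnit t • x = Real.exp t * x := by
  rw [Units.smul_def, smul_eq_mul, coe_expUnit]

/-- the module of a unit of `ℝ` acting on `(ℝ, dx)` by multiplication is its absolute value -/
theorem distribHaarChar_real_units (u : ℝˣ) : distribHaarChar ℝ u = ‖(u : ℝ)‖₊ := by
  have h1 : (volume : Measure ℝ) (Set.Icc (0:ℝ) 1) ≠ 0 := by simp
  have h2 : (volume : Measure ℝ) (Set.Icc (0:ℝ) 1) ≠ ∞ := by simp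
  refine distribHaarChar_eq_of_measure_smul_eq_mul (μ := volume) h1 h2 ?_
  have hset : (u • Set.Icc (0:ℝ) 1 : Set ℝ) = (u : ℝ) • Set.Icc (0:ℝ) 1 := by
    ext y; simp only [Set.mem_smul_set, Units.smul_def]
  rw [hset, Measure.addHaar_smul, Module.finrank_self, pow_one, ← Real.norm_eq_abs, ofReal_norm]
  rfl

/-- pv07's weight `ν(g) δ(g)^{1/2}` at `g = e^t`, `ν = 1`, is `e^{t/2}` -/
theorem weight_expUnit (t : ℝ) : weight ℝ (1 : ℝˣ →* Circle) (expUnit t) = (Real.exp (t / 2) : ℂ) := by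
  rw [weight, distribHaarChar_real_units, MonoidHom.one_apply, Circle.coe_one, one_mul]
  congr 1
  rw [Real.coe_sqrt, coe_nnnorm, coe_expUnit, Real.norm_eq_abs, abs_of_pos (Real.exp_pos t)]
  have h2 : Real.exp t = Real.exp (t / 2) ^ 2 := by
    rw [← Real.exp_nat_mul]; congr 1; push_cast; ring
  rw [h2, Real.sqrt_sq (Real.exp_pos _).le]

/-- the unitary dilation `(U t f)(x) = e^{t/2} f(e^t x)` on `L²(ℝ)` = pv07's `dilationRep volume 1 (e^t)` -/
def U (t : ℝ) : Lp ℂ 2 (volume : Measure ℝ) ≃ₗᵢ[ℂ] Lp ℂ 2 (volume : Measure ℝ) :=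
  dilationRep volume (1 : ℝˣ →* Circle) (expUnit t)

/-- (Ported verbatim from the HodgeCMPerL package; no docstring in the source.) -/
theorem U_def (t : ℝ) : U t = dilationRep volume (1 : ℝˣ →* Circle) (expUnit t) := rfl

/-- (Ported verbatim from the HodgeCMPerL package; no docstring in the source.) -/
@[simp] theorem U_zero : U 0 = 1 := by rw [U_def, expUnit_zero, map_one]

/-- group law `U (s + t) = U s ∘ U t` -/
theorem U_add (s t : ℝ) : U (s + t) = U s * U t := by rw [U_def, expUnit_add, map_mul]; rfl

/-- (Ported verbatim from the HodgeCMPerL package; no docstring in the source.) -/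
theorem U_add_apply (s t : ℝ) (f : Lp ℂ 2 (volume : Measure ℝ)) : U (s + t) f = U s (U t f) := by
  rw [U_add, LinearIsometryEquiv.coe_mul, Function.comp_apply]

/-- `(U t f)(x) = e^{t/2} f(e^t x)` for a.e. `x` -/
theorem coeFn_U (t : ℝ) (f : Lp ℂ 2 (volume : Measure ℝ)) :
    ⇑(U t f) =ᵐ[volume] fun x => (Real.exp (t / 2) : ℂ) * f (Real.exp t * x) := by
  filter_upwards [coeFn_dilationRep volume (1 : ℝˣ →* Circle) (expUnit t) f] with x hx
  rw [U_def, hx, weight_expUnit, expUnit_smul]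

/-- unitarity: `‖U t f‖ = ‖f‖` -/
theorem norm_U (t : ℝ) (f : Lp ℂ 2 (volume : Measure ℝ)) : ‖U t f‖ = ‖f‖ := (U t).norm_map f

/-! ## §2  The dilations on the Schwartz space and their generator `gen = ½ + x d/dx` -/

/-- multiplication by `e^t` as a continuous linear automorphism of `ℝ` -/
def scaleEquiv (t : ℝ) : ℝ ≃L[ℝ] ℝ :=
  (LinearEquiv.smulOfNeZero ℝ ℝ (Real.exp t) (Real.exp_pos t).ne').toContinuousLinearEquiv

/-- (Ported verbatim from the HodgeCMPerL package; no docstring in the source.) -/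
@[simp] theorem scaleEquiv_apply (t x : ℝ) : scaleEquiv t x = Real.exp t * x := rfl

/-- the dilation `(dil t Φ)(x) = e^{t/2} Φ(e^t x)` as a continuous linear operator on `𝓢(ℝ, ℂ)` -/
def dil (t : ℝ) : 𝓢(ℝ, ℂ) →L[ℂ] 𝓢(ℝ, ℂ) :=
  (Real.exp (t / 2) : ℂ) • compCLMOfContinuousLinearEquiv ℂ (scaleEquiv t)

/-- (Ported verbatim from the HodgeCMPerL package; no docstring in the source.) -/
@[simp] theorem dil_apply (t : ℝ) (Φ : 𝓢(ℝ, ℂ)) (x : ℝ) :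
    dil t Φ x = (Real.exp (t / 2) : ℂ) * Φ (Real.exp t * x) := by
  simp [dil]

/-- (Ported verbatim from the HodgeCMPerL package; no docstring in the source.) -/
@[simp] theorem dil_zero_apply (Φ : 𝓢(ℝ, ℂ)) (x : ℝ) : dil 0 Φ x = Φ x := by simp

/-- (Ported verbatim from the HodgeCMPerL package; no docstring in the source.) -/
theorem dil_zero (Φ : 𝓢(ℝ, ℂ)) : dil 0 Φ = Φ := by ext x; simp

/-- `x ↦ (x : ℂ)` has temperate growth (it is a continuous linear map) -/
theorem hasTemperateGrowth_ofReal : Function.HasTemperateGrowth (fun x : ℝ => (x : ℂ)) :=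
  Complex.ofRealCLM.hasTemperateGrowth

/-- the generator `gen Φ = ½ Φ + x Φ'` of the dilation group, a continuous linear operator on `𝓢(ℝ, ℂ)` -/
def gen : 𝓢(ℝ, ℂ) →L[ℂ] 𝓢(ℝ, ℂ) :=
  (1 / 2 : ℂ) • ContinuousLinearMap.id ℂ _ +
    (smulLeftCLM ℂ (fun x : ℝ => (x : ℂ))).comp (derivCLM ℂ ℂ)

/-- (Ported verbatim from the HodgeCMPerL package; no docstring in the source.) -/
@[simp] theorem gen_apply (Φ : 𝓢(ℝ, ℂ)) (x : ℝ) :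
    gen Φ x = (1 / 2 : ℂ) * Φ x + (x : ℂ) * deriv Φ x := by
  simp [gen, smulLeftCLM_apply_apply hasTemperateGrowth_ofReal]

/-- POINTWISE ENGINE: for every `x`, `s ↦ (dil s Φ)(x) = e^{s/2} Φ(e^s x)` is differentiable at every `t`
with derivative `(dil t (gen Φ))(x) = e^{t/2} (½ Φ + y Φ')(e^t x)`. -/
theorem hasDerivAt_dil_apply (Φ : 𝓢(ℝ, ℂ)) (x t : ℝ) :
    HasDerivAt (fun s => dil s Φ x) (dil t (gen Φ) x) t := by
  -- the scalar factor `s ↦ e^{s/2}`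
  have ha : HasDerivAt (fun s : ℝ => (Real.exp (s / 2) : ℂ)) ((Real.exp (t / 2) * (1 / 2) : ℝ) : ℂ) t := by
    refine HasDerivAt.ofReal_comp ?_
    have := ((hasDerivAt_id t).div_const 2).exp
    simpa using this
  -- the inner function `s ↦ Φ (e^s x)`
  have hu : HasDerivAt (fun s : ℝ => Real.exp s * x) (Real.exp t * x) t := by
    simpa using (Real.hasDerivAt_exp t).mul_const x
  have hΦ : HasDerivAt (fun s : ℝ => Φ (Real.exp s * x))
      ((Real.exp t * x) • deriv Φ (Real.exp t * x)) t :=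
    HasDerivAt.scomp t (Φ.hasDerivAt (Real.exp t * x)) hu
  have h := ha.mul hΦ
  have hfun : (fun s => dil s Φ x) = (fun s => (Real.exp (s / 2) : ℂ)) * fun s => Φ (Real.exp s * x) := by
    funext s; simp only [Pi.mul_apply, dil_apply]
  rw [hfun]
  refine h.congr_deriv ?_
  rw [dil_apply, gen_apply, Complex.real_smul]
  push_cast
  ring

/-! ## §3  The uniform Taylor bound in the Schwartz seminorms -/

/-- a two-step mean-value bound: if `φ` is twice differentiable with `‖φ''‖ ≤ C` on `|s| ≤ |h|`, then
`‖φ h − φ 0 − h • φ' 0‖ ≤ C h²` -/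
theorem taylor_two_bound {E : Type*} [NormedAddCommGroup E] [NormedSpace ℝ E]
    {φ φ' φ'' : ℝ → E} {h C : ℝ} (h1 : ∀ s, HasDerivAt φ (φ' s) s) (h2 : ∀ s, HasDerivAt φ' (φ'' s) s)
    (hb : ∀ s, |s| ≤ |h| → ‖φ'' s‖ ≤ C) : ‖φ h - φ 0 - h • φ' 0‖ ≤ C * h ^ 2 := by
  have hC : 0 ≤ C := le_trans (norm_nonneg _) (hb 0 (by simp))
  have hSconv : Convex ℝ (Set.uIcc (0 : ℝ) h) := convex_uIcc 0 h
  have hmemS : ∀ s ∈ Set.uIcc (0 : ℝ) h, |s| ≤ |h| := by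
    intro s hs
    rcases Set.mem_uIcc.mp hs with ⟨h0s, hsh⟩ | ⟨hhs, hs0⟩
    · rw [abs_of_nonneg h0s, abs_of_nonneg (h0s.trans hsh)]; exact hsh
    · rw [abs_of_nonpos hs0, abs_of_nonpos (hhs.trans hs0)]; exact neg_le_neg hhs
  -- first step: `‖φ' s − φ' 0‖ ≤ C |s| ≤ C |h|` on `[0, h]`
  have hstep : ∀ s ∈ Set.uIcc (0 : ℝ) h, ‖φ' s - φ' 0‖ ≤ C * |h| := by
    intro s hs
    have := hSconv.norm_image_sub_le_of_norm_hasDerivWithin_le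
      (fun u _ => (h2 u).hasDerivWithinAt) (fun u hu => hb u (hmemS u hu)) Set.left_mem_uIcc hs
    refine this.trans ?_
    rw [sub_zero, Real.norm_eq_abs]
    exact mul_le_mul_of_nonneg_left (hmemS s hs) hC
  -- second step on `ψ s = φ s − φ 0 − s • φ' 0`
  have hψ : ∀ s, HasDerivAt (fun s => φ s - φ 0 - s • φ' 0) (φ' s - φ' 0) s := by
    intro s
    have := ((h1 s).sub_const (φ 0)).sub ((hasDerivAt_id' s).smul_const (φ' 0))
    rw [one_smul] at this
    exact this
  have := hSconv.norm_image_sub_le_of_norm_hasDerivWithin_le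
    (fun u _ => (hψ u).hasDerivWithinAt) hstep Set.left_mem_uIcc Set.right_mem_uIcc
  simp only [sub_self, zero_smul, sub_zero, Real.norm_eq_abs] at this
  calc ‖φ h - φ 0 - h • φ' 0‖ ≤ C * |h| * |h| := this
    _ = C * h ^ 2 := by rw [mul_assoc, ← sq, sq_abs]

/-- the dilates by `e^s`, `|s| ≤ 1`, of a Schwartz function: `|x|^i ‖(dil s Ψ)(x)‖ ≤ e^{i+1/2} p_{i,0}(Ψ)` -/
theorem norm_pow_mul_dil_le (Ψ : 𝓢(ℝ, ℂ)) (i : ℕ) {s : ℝ} (hs : |s| ≤ 1) (x : ℝ) :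
    |x| ^ i * ‖dil s Ψ x‖ ≤ Real.exp (i + 1 / 2) * SchwartzMap.seminorm ℂ i 0 Ψ := by
  have hy : |x| ^ i = Real.exp (-(s * i)) * |Real.exp s * x| ^ i := by
    rw [abs_mul, abs_of_pos (Real.exp_pos s), mul_pow, ← Real.exp_nat_mul, ← mul_assoc,
      ← Real.exp_add]
    ring_nf; simp
  have hsem : |Real.exp s * x| ^ i * ‖Ψ (Real.exp s * x)‖ ≤ SchwartzMap.seminorm ℂ i 0 Ψ := by
    have := SchwartzMap.norm_pow_mul_le_seminorm ℂ Ψ i (Real.exp s * x)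
    rwa [Real.norm_eq_abs] at this
  have hexp : Real.exp (-(s * i)) * Real.exp (s / 2) ≤ Real.exp (i + 1 / 2) := by
    rw [← Real.exp_add, Real.exp_le_exp]
    have h1 : -(s * i) ≤ (i : ℝ) := by
      have := abs_le.mp hs
      nlinarith [Nat.cast_nonneg (α := ℝ) i]
    have h2 : s / 2 ≤ 1 / 2 := by linarith [(abs_le.mp hs).2]
    linarith
  rw [dil_apply, norm_mul, Complex.norm_real, Real.norm_eq_abs, abs_of_pos (Real.exp_pos _), hy]
  calc Real.exp (-(s * i)) * |Real.exp s * x| ^ i * (Real.exp (s / 2) * ‖Ψ (Real.exp s * x)‖)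
      = (Real.exp (-(s * i)) * Real.exp (s / 2)) * (|Real.exp s * x| ^ i * ‖Ψ (Real.exp s * x)‖) := by
        ring
    _ ≤ Real.exp (i + 1 / 2) * SchwartzMap.seminorm ℂ i 0 Ψ :=
        mul_le_mul hexp hsem (by positivity) (Real.exp_pos _).le

/-- the Schwartz-space remainder `rem h Φ = h⁻¹ (dil h Φ − Φ) − gen Φ` of the difference quotient -/
def rem (h : ℝ) (Φ : 𝓢(ℝ, ℂ)) : 𝓢(ℝ, ℂ) := (h⁻¹ : ℂ) • (dil h Φ - Φ) - gen Φ

/-- (Ported verbatim from the HodgeCMPerL package; no docstring in the source.) -/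
theorem rem_apply (h : ℝ) (Φ : 𝓢(ℝ, ℂ)) (x : ℝ) :
    rem h Φ x = (h⁻¹ : ℂ) * (dil h Φ x - Φ x) - gen Φ x := rfl

/-- (Ported verbatim from the HodgeCMPerL package; no docstring in the source.) -/
theorem smul_rem (h : ℝ) (hh : h ≠ 0) (Φ : 𝓢(ℝ, ℂ)) :
    (h : ℂ) • rem h Φ = dil h Φ - Φ - (h : ℂ) • gen Φ := by
  have hh' : (h : ℂ) ≠ 0 := Complex.ofReal_ne_zero.mpr hh
  rw [rem, smul_sub, smul_smul, mul_inv_cancel₀ hh', one_smul]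

/-- THE BOUND: `|x|^i ‖(rem h Φ)(x)‖ ≤ |h| · e^{i+1/2} · p_{i,0}(gen (gen Φ))` for `0 < |h| ≤ 1` -/
theorem norm_pow_mul_rem_le (Φ : 𝓢(ℝ, ℂ)) (i : ℕ) {h : ℝ} (hh : h ≠ 0) (hh1 : |h| ≤ 1) (x : ℝ) :
    |x| ^ i * ‖rem h Φ x‖ ≤
      |h| * (Real.exp (i + 1 / 2) * SchwartzMap.seminorm ℂ i 0 (gen (gen Φ))) := by
  set K := Real.exp (i + 1 / 2) * SchwartzMap.seminorm ℂ i 0 (gen (gen Φ)) with hK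
  set c : ℂ := ((|x| ^ i : ℝ) : ℂ) with hc
  -- Taylor bound for `φ s = |x|^i · (dil s Φ)(x)`
  have hT := taylor_two_bound (E := ℂ) (h := h) (C := K)
    (φ := fun s => c * dil s Φ x) (φ' := fun s => c * dil s (gen Φ) x)
    (φ'' := fun s => c * dil s (gen (gen Φ)) x)
    (fun s => (hasDerivAt_dil_apply Φ x s).const_mul c)
    (fun s => (hasDerivAt_dil_apply (gen Φ) x s).const_mul c)
    (fun s hs => by
      rw [norm_mul, hc, Complex.norm_real, Real.norm_eq_abs, abs_pow, abs_abs]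
      exact norm_pow_mul_dil_le (gen (gen Φ)) i (hs.trans hh1) x)
  -- rewrite the left-hand side of the Taylor bound as `|x|^i |h| ‖rem h Φ x‖`
  have hh' : (h : ℂ) ≠ 0 := Complex.ofReal_ne_zero.mpr hh
  have hlhs : c * dil h Φ x - c * dil 0 Φ x - h • (c * dil 0 (gen Φ) x)
      = ((|x| ^ i * h : ℝ) : ℂ) * rem h Φ x := by
    rw [dil_zero_apply, dil_zero_apply, rem_apply, Complex.real_smul, hc]
    push_cast
    field_simp
  rw [hlhs, norm_mul, Complex.norm_real, Real.norm_eq_abs, abs_mul, abs_pow, abs_abs] at hT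
  -- divide by `|h| > 0`
  have hpos : 0 < |h| := abs_pos.mpr hh
  have : |x| ^ i * ‖rem h Φ x‖ * |h| ≤ |h| * K * |h| := by
    calc |x| ^ i * ‖rem h Φ x‖ * |h| = |x| ^ i * |h| * ‖rem h Φ x‖ := by ring
      _ ≤ K * h ^ 2 := hT
      _ = |h| * K * |h| := by rw [← sq_abs]; ring
  exact le_of_mul_le_mul_right this hpos

/-- every Schwartz seminorm `p_{i,0}` of the remainder is `O(|h|)` -/
theorem seminorm_rem_le (Φ : 𝓢(ℝ, ℂ)) (i : ℕ) {h : ℝ} (hh : h ≠ 0) (hh1 : |h| ≤ 1) :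
    SchwartzMap.seminorm ℂ i 0 (rem h Φ) ≤
      |h| * (Real.exp (i + 1 / 2) * SchwartzMap.seminorm ℂ i 0 (gen (gen Φ))) := by
  refine SchwartzMap.seminorm_le_bound ℂ i 0 (rem h Φ) (by positivity) fun x => ?_
  rw [norm_iteratedFDeriv_zero, Real.norm_eq_abs]
  exact norm_pow_mul_rem_le Φ i hh hh1 x

/-- the `L²` norm of the remainder is `O(|h|)`: `‖(rem h Φ).toLp 2‖ ≤ C |h|` for `0 < |h| ≤ 1` -/
theorem norm_toLp_rem_le (Φ : 𝓢(ℝ, ℂ)) :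
    ∃ C : ℝ, 0 ≤ C ∧ ∀ h : ℝ, h ≠ 0 → |h| ≤ 1 →
      ‖(rem h Φ).toLp 2 (volume : Measure ℝ)‖ ≤ C * |h| := by
  obtain ⟨k, C, hC0, hC⟩ := SchwartzMap.norm_toLp_le_seminorm ℂ ℂ (2 : ℝ≥0∞) (volume : Measure ℝ)
  -- one constant dominating all the `K_i`, `i ≤ k`
  set K : ℝ := Real.exp (k + 1 / 2) *
    ∑ i ∈ Finset.range (k + 1), SchwartzMap.seminorm ℂ i 0 (gen (gen Φ)) with hK
  have hK0 : 0 ≤ K := by positivity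
  refine ⟨C * K, mul_nonneg hC0 hK0, fun h hh hh1 => ?_⟩
  refine (hC (rem h Φ)).trans ?_
  rw [mul_assoc]
  refine mul_le_mul_of_nonneg_left ?_ hC0
  refine Seminorm.finset_sup_apply_le (by positivity) fun m hm => ?_
  obtain ⟨hm1, hm2⟩ : m.1 ≤ k ∧ m.2 ≤ 0 := Finset.mem_Iic.mp hm
  have hm2' : m.2 = 0 := Nat.le_zero.mp hm2
  have hfam : schwartzSeminormFamily ℂ ℝ ℂ m = SchwartzMap.seminorm ℂ m.1 0 := by
    rw [← hm2']; rfl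
  rw [hfam]
  refine (seminorm_rem_le Φ m.1 hh hh1).trans ?_
  rw [mul_comm |h| _]
  refine mul_le_mul_of_nonneg_right ?_ (abs_nonneg h)
  refine mul_le_mul ?_ ?_ (by positivity) (by positivity)
  · have hm1' : (m.1 : ℝ) ≤ k := by exact_mod_cast hm1
    exact Real.exp_le_exp.mpr (by linarith)
  · exact Finset.single_le_sum (f := fun i => SchwartzMap.seminorm ℂ i 0 (gen (gen Φ)))
      (fun i _ => apply_nonneg _ _) (Finset.mem_range.mpr (Nat.lt_succ_of_le hm1))

/-! ## §4  The `L²` derivative: door [D5‴] for the dilation group -/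

/-- `toLp` is linear (Mathlib's `toLpCLM`), in the form needed here -/
theorem toLp_sub_sub_smul (Φ Ψ Ξ : 𝓢(ℝ, ℂ)) (c : ℂ) :
    (Φ - Ψ - c • Ξ).toLp 2 (volume : Measure ℝ) = Φ.toLp 2 volume - Ψ.toLp 2 volume - c • Ξ.toLp 2 volume := by
  simp only [← SchwartzMap.toLpCLM_apply (𝕜 := ℂ), map_sub, map_smul]

/-- (Ported verbatim from the HodgeCMPerL package; no docstring in the source.) -/
theorem toLp_smul (c : ℂ) (Φ : 𝓢(ℝ, ℂ)) :
    (c • Φ).toLp 2 (volume : Measure ℝ) = c • Φ.toLp 2 volume := by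
  simp only [← SchwartzMap.toLpCLM_apply (𝕜 := ℂ), map_smul]

/-- on the Schwartz space the unitary dilation IS `dil`: `U t Φ = dil t Φ` in `L²(ℝ)` -/
theorem toLp_dil (t : ℝ) (Φ : 𝓢(ℝ, ℂ)) :
    U t (Φ.toLp 2 (volume : Measure ℝ)) = (dil t Φ).toLp 2 volume := by
  apply Lp.ext
  have h1 := coeFn_U t (Φ.toLp 2 (volume : Measure ℝ))
  have h2 : (fun x => (Φ.toLp 2 (volume : Measure ℝ) : ℝ → ℂ) (Real.exp t * x)) =ᵐ[volume]
      fun x => Φ (Real.exp t * x) := by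
    have hq := (quasiMeasurePreserving_smul' (volume : Measure ℝ) (expUnit t)).ae_eq_comp
      (SchwartzMap.coeFn_toLp Φ 2 (volume : Measure ℝ))
    simpa only [Function.comp_def, expUnit_smul] using hq
  have h3 := SchwartzMap.coeFn_toLp (dil t Φ) 2 (volume : Measure ℝ)
  filter_upwards [h1, h2, h3] with x hx1 hx2 hx3
  rw [hx1, hx2, hx3, dil_apply]

/-- door [D5‴] at `t₀ = 0`, Schwartz form: `t ↦ dil t Φ` is differentiable at `0` IN `L²(ℝ)` with derivative
`gen Φ = ½ Φ + x Φ'` -/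
theorem hasDerivAt_toLp_dil_zero (Φ : 𝓢(ℝ, ℂ)) :
    HasDerivAt (fun t : ℝ => (dil t Φ).toLp 2 (volume : Measure ℝ)) ((gen Φ).toLp 2 volume) 0 := by
  obtain ⟨C, hC0, hC⟩ := norm_toLp_rem_le Φ
  rw [hasDerivAt_iff_isLittleO_nhds_zero]
  refine Asymptotics.isLittleO_iff.mpr fun ε hε => ?_
  have hδ : 0 < min 1 (ε / (C + 1)) := lt_min one_pos (div_pos hε (by linarith))
  filter_upwards [Metric.ball_mem_nhds (0 : ℝ) hδ] with h hhδ
  rw [Metric.mem_ball, dist_zero_right, Real.norm_eq_abs, lt_min_iff] at hhδ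
  rcases eq_or_ne h 0 with rfl | hh
  · simp [dil_zero]
  have hsm : (h • (gen Φ).toLp 2 (volume : Measure ℝ) : Lp ℂ 2 (volume : Measure ℝ))
      = (h : ℂ) • (gen Φ).toLp 2 volume := RCLike.real_smul_eq_coe_smul (K := ℂ) h _
  have key : (dil (0 + h) Φ).toLp 2 (volume : Measure ℝ) - (dil 0 Φ).toLp 2 volume
        - (h : ℂ) • (gen Φ).toLp 2 volume = (h : ℂ) • (rem h Φ).toLp 2 volume := by
    rw [zero_add, dil_zero, ← toLp_smul (h : ℂ) (rem h Φ), smul_rem h hh, toLp_sub_sub_smul]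
  rw [hsm, key, norm_smul, Complex.norm_real, Real.norm_eq_abs]
  calc |h| * ‖(rem h Φ).toLp 2 (volume : Measure ℝ)‖ ≤ |h| * (C * |h|) :=
        mul_le_mul_of_nonneg_left (hC h hh hhδ.1.le) (abs_nonneg h)
    _ = (C * |h|) * |h| := by ring
    _ ≤ ε * |h| := by
        refine mul_le_mul_of_nonneg_right ?_ (abs_nonneg h)
        have : C * |h| ≤ C * (ε / (C + 1)) := mul_le_mul_of_nonneg_left hhδ.2.le hC0
        refine this.trans ?_
        rw [mul_div_assoc']
        exact (div_le_iff₀ (by linarith)).mpr (by nlinarith)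


-- port_pkg: scope closed for this part
end HodgeCM.PerL34.ArchC.DilationToy
end
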